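import Literature.AlgebraicGeometry.Resolution.NeronPopescuDesingularizationAlgebra
import Mathlib.RingTheory.Extension.Presentation.Submersive
import Mathlib.RingTheory.Smooth.StandardSmoothCotangent
import Mathlib.RingTheory.Smooth.Flat
import Mathlib.RingTheory.Smooth.Locus
import Mathlib.RingTheory.Localization.LocalizationLocalization
import Mathlib.RingTheory.Localization.AtPrime.Basic
import HarnessLib

/-!
# The desingularization lemma (Stacks 07CR), II: the case `π ∈ 𝔮` and the lemma itself

Topic: `Literature/AlgebraicGeometry/Resolution`. The Stacks Project, *Smoothing Ring Maps*
(Tag 07BW), Lemma 07CR (= Lemma 16.7.1):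

> **Lemma 07CR.** Let `R` be a Noetherian ring. Let `Λ` be an `R`-algebra. Let `π ∈ R` and assume
> that `Ann_Λ(π) = Ann_Λ(π²)`. Let `A → Λ` be an `R`-algebra map with `A` of finite presentation.
> Assume (1) the image of `π` is strictly standard in `A` over `R`, and (2) there exists a
> section `ρ : A/π⁴A → R/π⁴R` which is compatible with the map to `Λ/π⁴Λ`. Then we can find
> `R`-algebra maps `A → B → Λ` with `B` of finite presentation such that `𝔞B ⊂ H_{B/R}` where
> `𝔞 = Ann_R(Ann_R(π²)/Ann_R(π))`.

Main statement: `Stacks07CR_desingularization` (with `𝔞B ⊆ H_{B/R}` rendered elementwise: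
every `r ∈ R` with `r · Ann_R(π²) ⊆ Ann_R(π)` maps into `singularIdeal R B`, Stacks 07C5). Part I
(`NeronPopescuDesingularizationAlgebra.lean`) constructs `B`, the maps and treats `π ∉ 𝔮`; this
file treats the last paragraph of the printed proof and derives the numerical data from (1), (2).

## The case `π ∈ 𝔮`, `𝔞 ⊄ 𝔮` (Stacks, last paragraph of the proof) and its rendering

Stacks: "Set `B' = R[v, w]/(g_1, …, g_c)`. As `g_i = v_i + ∑ r_{ji}w_i mod π` we see that
`B'/πB' = R/πR[w_1, …, w_n]`. Hence `R → B'` is smooth of relative dimension `n` at every point of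
`V(π)` by Algebra, Lemmas 00SV and [flat-fibre-smooth] … We claim the surjection `B' → B` induces
an isomorphism of local rings `(B')_{𝔮'} → B_𝔮` … the image of `f_{c+j}` in `(B')_{𝔮'}` is
divisible by `π²` … the image of `πf_{c+j}` … can be written as `∑ b_{j₁j₂} f_{c+j₁}f_{c+j₂}` by
(07CS) … Hence `πf_{c+j} = 0` in `(B')_{𝔮'}` as this is a Noetherian local ring, see Algebra,
Lemma [Krull/Nakayama]. As `R → (B')_{𝔮'}` is flat we see that
`(Ann_R(π²)/Ann_R(π)) ⊗_R (B')_{𝔮'} = Ann_{(B')_{𝔮'}}(π²)/Ann_{(B')_{𝔮'}}(π)`. Because `r ∈ 𝔞` is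
invertible in `(B')_{𝔮'}` we see that this module is zero. Hence … `f_{c+j}` is zero in
`(B')_{𝔮'}`."

Rendering:
* smoothness of `B'` near `V(π)`: instead of the fibrewise criterion we use the **Jacobian**:
  `∂g_j/∂v_i ≡ u δ_{ij} mod π` and `u ≡ 1 mod π³`, so `det(∂g_j/∂v_i) = 1 + πz`
  (`exists_jacobiMatrix_det_eq`), and `B'` becomes standard smooth after inverting this
  determinant (`isStandardSmooth_away_jacobian`: the naive pre-submersive presentation of `B'`
  composed with the localization presentation, Mathlib `IsStandardSmooth ⇒ Smooth`); the
  determinant lies in no prime containing `π` (`jacobian_notMem`);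
* `(B')_{𝔮'}` is realised as the local ring `L` at `𝔮'B'_{det}` of the smooth (hence flat,
  Mathlib `Algebra.Smooth.flat`) algebra `B'_{det}`; in `L`: `f̃_j = π²y_j`
  (`exists_subst_eq_C_sq_mul`), `πf̃_j ∈ (f̃)²` (from (16.2.3.4), `pi_mul_fB'_mem_sq`), Nakayama
  (`Submodule.eq_bot_of_le_smul_of_le_jacobson_bot`) gives `πf̃_j = 0`, the flatness statement is
  `mem_map_ker_of_mul_eq_zero` / `pi_mul_eq_zero_of_sq`, whence `f̃_j = 0` in `L` and some
  `s ∉ 𝔮'` kills all `f̃_j` in `B'` (`exists_notMem_mul_fB'_eq_zero`);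
* then `B_{s·det}` is a retract of the formally smooth `B'_{s·det}`, so `B` is (formally) smooth
  at `𝔮` (`exists_formallySmooth_away_of_prime`); with part I's `B_π` this gives
  `𝔞B ⊆ H_{B/R}` (`algebraMap_mem_singularIdeal`, via `mem_singularIdeal_iff` and Mathlib's
  `basicOpen_subset_smoothLocus_iff`);
* `Stacks07CR_desingularization` derives `r`, `t_j`, `u = 1 - π³t₀`, the matrix `(s_{ik})`
  (Algebra 07DQ (1), `exists_matrix_mul_eq_smul_one`) and `λ_i` from (1), (2) and `ρ` exactly as
  in the first two paragraphs of the printed proof.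

## References

* The Stacks Project, *Smoothing Ring Maps* (Tag 07BW), Lemma 07CR and its proof; Definition
  07C7, Lemma 07CA; *Commutative Algebra*, Lemma 07DQ. [StacksProject]
-/

noncomputable section

open MvPolynomial TensorProduct

namespace Literature.AlgebraicGeometry.Resolution

universe u

namespace Stacks07CR

/-! ## ST6. The algebra `B' = R[v, w]/(g_1, …, g_c)` and its Jacobian -/

section Bprime

variable {R : Type u} [CommRing R] {A : Type u} [CommRing A] [Algebra R A] {n m c : ℕ}
  (P : Algebra.Presentation R A (Fin n) (Fin m)) (hcm : c ≤ m)
  (π : R) (r : Fin n → R) (Bm : Matrix (Fin c) (Fin n) R) (u : R) (t : Fin m → R)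

/-- The relations `g_1, …, g_c` of `B'`. [cite: StacksProject, Tag 07CR] -/
def gB' (j' : Fin c) : MvPolynomial (V c n) R := relB P hcm π r Bm u t (Fin.castLE hcm j')

/-- `g_j` as a `gPoly`. [cite: StacksProject, Tag 07CR] -/
theorem gB'_eq (j' : Fin c) : gB' P hcm π r Bm u t j' =
    gPoly π r Bm (Jr P hcm r) u (t (Fin.castLE hcm j')) j' (P.relation (Fin.castLE hcm j')) := by
  rw [gB', relB, dif_pos (show ((Fin.castLE hcm j' : Fin m) : ℕ) < c from j'.2)]
  rfl

/-- **The algebra `B' = R[v, w]/(g_1, …, g_c)`** of Stacks 07CR. [cite: StacksProject, Tag 07CR] -/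
abbrev B'alg : Type u := MvPolynomial (V c n) R ⧸ Ideal.span (Set.range (gB' P hcm π r Bm u t))

/-- `(g) ⊆ (g, f̃)`. [folklore] -/
theorem span_gB'_le : Ideal.span (Set.range (gB' P hcm π r Bm u t)) ≤ idealB P hcm π r Bm u t := by
  refine Ideal.span_mono ?_
  rintro _ ⟨j', rfl⟩
  exact ⟨Fin.castLE hcm j', rfl⟩

/-- The surjection `B' → B`. [cite: StacksProject, Tag 07CR] -/
def B'toB : B'alg P hcm π r Bm u t →ₐ[R] Balg P hcm π r Bm u t :=
  Ideal.Quotient.factorₐ R (span_gB'_le P hcm π r Bm u t)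

/-- Formula for `B' → B`. [folklore] -/
theorem B'toB_mk (p : MvPolynomial (V c n) R) :
    B'toB P hcm π r Bm u t (Ideal.Quotient.mk _ p) = Ideal.Quotient.mk _ p := rfl

/-- The naive pre-submersive presentation of `B'` with the `v_j` as distinguished variables.
[cite: StacksProject, Tag 07CR] -/
def preB' : Algebra.PreSubmersivePresentation R (B'alg P hcm π r Bm u t) (V c n) (Fin c) :=
  Algebra.PreSubmersivePresentation.naive Sum.inl Sum.inl_injective

/-- `∂g_j/∂v_i = u δ_{ij} + π ∂q_j/∂v_i`. [cite: StacksProject, Tag 07CR] -/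
theorem pderiv_inl_gB' (i j : Fin c) :
    pderiv (Sum.inl i) (gB' P hcm π r Bm u t j) =
      C u * (if j = i then 1 else 0) + C π * pderiv (Sum.inl i)
        (qPoly π r Bm (P.relation (Fin.castLE hcm j))) := by
  classical
  rw [gB'_eq, gPoly]
  simp only [map_add, map_mul, Derivation.leibniz, pderiv_C, pderiv_X, zero_add,
    add_zero, smul_eq_mul, map_sum, mul_zero, Finset.sum_const_zero, Pi.single_apply,
    Sum.inl.injEq, reduceCtorEq, if_false]

variable {t₀ : R} (hu : u = 1 - π ^ 3 * t₀)

include hu in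
/-- **The Jacobian of `B'` is `≡ 1 mod π`**: `det(∂g_j/∂v_i) = 1 + π z` (as `∂g_j/∂v_i ≡ u δ_{ij}`,
`u ≡ 1 mod π`). This replaces Stacks' "R → B' is smooth of relative dimension `n` at every point
of `V(π)` by Algebra, Lemmas 00SV and flat-fibre-smooth": `B'` becomes standard smooth after
inverting the Jacobian, which is invertible on `V(π)`. [cite: StacksProject, Tag 07CR] -/
theorem exists_jacobiMatrix_det_eq :
    ∃ z : MvPolynomial (V c n) R, (preB' P hcm π r Bm u t).jacobiMatrix.det = 1 + C π * z := by
  classical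
  let Q := MvPolynomial (V c n) R ⧸ Ideal.span {(C π : MvPolynomial (V c n) R)}
  have hπ : Ideal.Quotient.mk (Ideal.span {(C π : MvPolynomial (V c n) R)}) (C π) = 0 :=
    Ideal.Quotient.eq_zero_iff_mem.mpr (Ideal.mem_span_singleton_self _)
  have hu' : Ideal.Quotient.mk (Ideal.span {(C π : MvPolynomial (V c n) R)}) (C u) = 1 := by
    rw [hu, map_sub, map_one, map_mul, map_pow, map_sub, map_one, map_mul, map_pow, hπ]
    ring
  have hmat : (preB' P hcm π r Bm u t).jacobiMatrix.map
      (Ideal.Quotient.mk (Ideal.span {(C π : MvPolynomial (V c n) R)})) = 1 := by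
    ext i j
    rw [Matrix.map_apply, preB', Algebra.PreSubmersivePresentation.jacobiMatrix_naive,
      pderiv_inl_gB', map_add, map_mul, map_mul, hu', hπ, one_mul, zero_mul, add_zero,
      Matrix.one_apply]
    split_ifs with h1 h2 h2
    · rw [map_one]
    · exact absurd h1.symm h2
    · exact absurd h2.symm h1
    · rw [map_zero]
  have hdet : Ideal.Quotient.mk (Ideal.span {(C π : MvPolynomial (V c n) R)})
      ((preB' P hcm π r Bm u t).jacobiMatrix.det - 1) = 0 := by
    rw [map_sub, RingHom.map_det, RingHom.mapMatrix_apply, hmat, Matrix.det_one, map_one, sub_self]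
  obtain ⟨z, hz⟩ := Ideal.mem_span_singleton'.mp (Ideal.Quotient.eq_zero_iff_mem.mp hdet)
  exact ⟨z, by rw [mul_comm, hz]; ring⟩

include hu in
/-- Hence the Jacobian of `B'` is `1 + π z` in `B'`. [cite: StacksProject, Tag 07CR] -/
theorem exists_jacobian_eq : ∃ z : B'alg P hcm π r Bm u t,
    (preB' P hcm π r Bm u t).jacobian = 1 + algebraMap R _ π * z := by
  classical
  obtain ⟨z, hz⟩ := exists_jacobiMatrix_det_eq P hcm π r Bm u t hu
  refine ⟨algebraMap _ _ z, ?_⟩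
  rw [Algebra.PreSubmersivePresentation.jacobian_eq_jacobiMatrix_det, hz, map_add, map_one,
    map_mul, IsScalarTower.algebraMap_apply R (MvPolynomial (V c n) R) (B'alg P hcm π r Bm u t),
    MvPolynomial.algebraMap_eq]
  rfl

/-- **`B'` is standard smooth after inverting its Jacobian** (composition of the naive
presentation of `B'` with the localization presentation). [cite: StacksProject, Tag 07CR] -/
theorem isStandardSmooth_away_jacobian :
    Algebra.IsStandardSmooth R (Localization.Away (preB' P hcm π r Bm u t).jacobian) := by
  let P₁ := preB' P hcm π r Bm u t
  let P₂ := Algebra.SubmersivePresentation.localizationAway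
    (Localization.Away P₁.jacobian) P₁.jacobian
  let Pc : Algebra.PreSubmersivePresentation R (Localization.Away P₁.jacobian)
      (Unit ⊕ V c n) (Unit ⊕ Fin c) := P₂.toPreSubmersivePresentation.comp P₁
  have hunit : IsUnit Pc.jacobian := by
    rw [Algebra.PreSubmersivePresentation.comp_jacobian_eq_jacobian_smul_jacobian, Algebra.smul_def,
      IsUnit.mul_iff]
    exact ⟨IsLocalization.Away.algebraMap_isUnit _, P₂.jacobian_isUnit⟩
  exact Algebra.SubmersivePresentation.isStandardSmooth ⟨Pc, hunit⟩

/-- … hence smooth over `R`. [cite: StacksProject, Tag 07CR] -/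
theorem smooth_away_jacobian :
    Algebra.Smooth R (Localization.Away (preB' P hcm π r Bm u t).jacobian) := by
  haveI := isStandardSmooth_away_jacobian P hcm π r Bm u t
  infer_instance

/-! ### Annihilators under flat base change -/

omit [Algebra R A] in
/-- **Annihilators commute with flat base change** (Stacks 07CR: "As `R → (B')_{𝔮'}` is flat we see
that `(Ann_R(π²)/Ann_R(π)) ⊗_R (B')_{𝔮'} = Ann_{(B')_{𝔮'}}(π²)/Ann_{(B')_{𝔮'}}(π)`"), in the
form: over a flat `R`-algebra `L`, every `z` with `xz = 0` lies in `Ann_R(x)L`. [folklore] -/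
theorem mem_map_ker_of_mul_eq_zero {L : Type u} [CommRing L] [Algebra R L] [Module.Flat R L]
    (x : R) (z : L) (hz : algebraMap R L x * z = 0) :
    z ∈ Ideal.map (algebraMap R L) (LinearMap.ker (LinearMap.mul R R x)) := by
  set K : Ideal R := LinearMap.ker (LinearMap.mul R R x)
  have hex : Function.Exact K.subtype (LinearMap.mul R R x) := LinearMap.exact_subtype_ker_map _
  have hexL := Module.Flat.lTensor_exact L hex
  -- `z ⊗ 1 ↦ z ⊗ x = (x z) ⊗ 1 = 0`
  have hz' : (LinearMap.mul R R x).lTensor L (z ⊗ₜ[R] (1 : R)) = 0 := by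
    rw [LinearMap.lTensor_tmul, LinearMap.mul_apply', mul_one, ← mul_one x, ← smul_eq_mul,
      TensorProduct.tmul_smul, TensorProduct.smul_tmul', Algebra.smul_def, hz,
      TensorProduct.zero_tmul]
  obtain ⟨w, hw⟩ := (hexL _).mp hz'
  -- every element of `L ⊗ K` lands in `K L` under `L ⊗ R ≅ L`
  have hmem : ∀ w : L ⊗[R] K, TensorProduct.rid R L (K.subtype.lTensor L w) ∈
      Ideal.map (algebraMap R L) K := by
    intro w
    induction w using TensorProduct.induction_on with
    | zero => simp only [map_zero]; exact Submodule.zero_mem _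
    | tmul l a =>
      rw [LinearMap.lTensor_tmul, TensorProduct.rid_tmul, Submodule.subtype_apply, Algebra.smul_def,
        mul_comm]
      exact Ideal.mul_mem_left _ _ (Ideal.mem_map_of_mem _ a.2)
    | add w₁ w₂ h₁ h₂ => rw [map_add, map_add]; exact Submodule.add_mem _ h₁ h₂
  have := hmem w
  rwa [hw, TensorProduct.rid_tmul, one_smul] at this

omit [Algebra R A] in
/-- If `L` is flat over `R`, `r₀ · Ann_R(π²) ⊆ Ann_R(π)` and `r₀` is a unit in `L`, then
`Ann_L(π²) = Ann_L(π)` (Stacks 07CR: "Because `r ∈ 𝔞` is invertible in `(B')_{𝔮'}` we see that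
this module is zero"). [cite: StacksProject, Tag 07CR] -/
theorem pi_mul_eq_zero_of_sq {L : Type u} [CommRing L] [Algebra R L] [Module.Flat R L]
    {r₀ : R} (hr₀ : ∀ s : R, π ^ 2 * s = 0 → π * (r₀ * s) = 0) (hunit : IsUnit (algebraMap R L r₀))
    (z : L) (hz : algebraMap R L π ^ 2 * z = 0) : algebraMap R L π * z = 0 := by
  rw [← map_pow] at hz
  have hmem := mem_map_ker_of_mul_eq_zero (π ^ 2) z hz
  -- `π r₀ z = 0`
  have h1 : algebraMap R L π * (algebraMap R L r₀ * z) = 0 := by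
    refine Submodule.span_induction (p := fun y _ => algebraMap R L π * (algebraMap R L r₀ * y) = 0)
      ?_ ?_ ?_ ?_ hmem
    · rintro _ ⟨s, hs, rfl⟩
      have hs' : π ^ 2 * s = 0 := by simpa [LinearMap.mul_apply'] using hs
      rw [← map_mul, ← map_mul, hr₀ s hs', map_zero]
    · simp
    · intro a b _ _ ha hb; rw [mul_add, mul_add, ha, hb, add_zero]
    · intro l a _ ha
      rw [smul_eq_mul, show algebraMap R L π * (algebraMap R L r₀ * (l * a)) =
        l * (algebraMap R L π * (algebraMap R L r₀ * a)) by ring, ha, mul_zero]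
  have h2 : algebraMap R L r₀ * (algebraMap R L π * z) = 0 := by rw [mul_left_comm]; exact h1
  exact hunit.mul_right_eq_zero.mp h2

/-! ### The relations `f̃_j`, `j > c`, vanish locally on `V(π) ∖ V(𝔞)` -/

/-- `f̃_j ∈ B'`. [cite: StacksProject, Tag 07CR] -/
abbrev fB' (j : Fin m) : B'alg P hcm π r Bm u t :=
  Ideal.Quotient.mk _ (subst π r Bm (P.relation j))

variable (ht : ∀ j, aeval r (P.relation j) = π ^ 4 * t j)
  (hBm : Bm * Jr P hcm r = (u * π) • (1 : Matrix (Fin c) (Fin c) R))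

include ht hBm in
/-- `f̃_k = π³ g_k = 0` in `B'` for `k ≤ c`. [cite: StacksProject, Tag 07CR] -/
theorem fB'_castLE (k : Fin c) : fB' P hcm π r Bm u t (Fin.castLE hcm k) = 0 := by
  rw [fB', ← C_mul_relB_of_lt P hcm π r Bm u t ht hBm (Fin.castLE hcm k) k.2,
    Ideal.Quotient.eq_zero_iff_mem]
  exact Ideal.mul_mem_left _ _ (Ideal.subset_span ⟨k, rfl⟩)

include ht hBm in
/-- **(16.2.3.4) transported to `B'`**: `π f̃_j ∈ (f̃_1, …, f̃_m)²` in `B'` (Stacks 07CR: "the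
image of `π f_{c+j}` … can be written as `∑ b_{j₁j₂} f_{c+j₁} f_{c+j₂}` by (07CS)").
[cite: StacksProject, Tag 07CR] -/
theorem pi_mul_fB'_mem_sq (h34 : LiftCond P (algebraMap R A π) c hcm) (j : Fin m) :
    algebraMap R _ π * fB' P hcm π r Bm u t j ∈
      (Ideal.span (Set.range (fB' P hcm π r Bm u t))) ^ 2 := by
  have hmem := h34.mem (C π) (by rw [aeval_C]) j
  let ψ : MvPolynomial (Fin n) R →+* B'alg P hcm π r Bm u t :=
    (Ideal.Quotient.mk _).comp (subst π r Bm : MvPolynomial (Fin n) R →ₐ[R] _).toRingHom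
  have hψ := Ideal.mem_map_of_mem ψ hmem
  rw [map_mul, Ideal.map_sup, Ideal.map_pow, Ideal.map_span, ← Set.range_comp] at hψ
  rw [← P.span_range_relation_eq_ker, Ideal.map_span, ← Set.range_comp] at hψ
  have h0 : Ideal.span (Set.range (ψ ∘ P.relation ∘ Fin.castLE hcm)) = ⊥ := by
    rw [Ideal.span_eq_bot]
    rintro _ ⟨k, rfl⟩
    exact fB'_castLE P hcm π r Bm u t ht hBm k
  rw [show (ψ ∘ (P.relation ∘ Fin.castLE hcm)) = ψ ∘ P.relation ∘ Fin.castLE hcm from rfl, h0,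
    bot_sup_eq] at hψ
  have e1 : ψ (C π) = algebraMap R _ π := by
    change Ideal.Quotient.mk _ (subst π r Bm (C π)) = _
    rw [aeval_C]
    rfl
  have e2 : (ψ ∘ P.relation) = fB' P hcm π r Bm u t := rfl
  rw [e1, e2] at hψ
  exact hψ

/-- `B'` is of finite presentation over `R`. [cite: StacksProject, Tag 07CR] -/
instance : Algebra.FinitePresentation R (B'alg P hcm π r Bm u t) :=
  Algebra.FinitePresentation.quotient (Submodule.fg_span (Set.finite_range _))

include hu in
/-- The Jacobian of `B'` lies in no prime containing `π`. [cite: StacksProject, Tag 07CR] -/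
theorem jacobian_notMem {𝔮' : Ideal (B'alg P hcm π r Bm u t)} [𝔮'.IsPrime]
    (hπ : algebraMap R _ π ∈ 𝔮') : (preB' P hcm π r Bm u t).jacobian ∉ 𝔮' := by
  obtain ⟨z, hz⟩ := exists_jacobian_eq P hcm π r Bm u t hu
  intro h
  apply ‹𝔮'.IsPrime›.ne_top
  rw [Ideal.eq_top_iff_one, show (1 : B'alg P hcm π r Bm u t) =
    (preB' P hcm π r Bm u t).jacobian - algebraMap R _ π * z by rw [hz]; ring]
  exact Ideal.sub_mem _ h (Ideal.mul_mem_right _ _ hπ)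

include ht hBm hu in
set_option maxHeartbeats 800000 in
/-- **The heart of the case `π ∈ 𝔮`** (Stacks 07CR, last paragraph): in the local ring of `B'` at
a prime `𝔮' ∋ π` avoiding `𝔞`, the images of `f̃_{c+1}, …, f̃_m` vanish. "First the image of
`f_{c+j}` in `(B')_{𝔮'}` is divisible by `π²` and second the image of `πf_{c+j}` … can be written
as `∑ b_{j₁j₂} f_{c+j₁}f_{c+j₂}` … Hence `πf_{c+j} = 0` in `(B')_{𝔮'}` as this is a Noetherian
local ring [Nakayama/Krull]. As `R → (B')_{𝔮'}` is flat … `Ann(π²)/Ann(π) = 0` … Hence the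
image of `f_{c+j}` is zero in `(B')_{𝔮'}`." (We realise `(B')_{𝔮'}` as the local ring at `𝔮'`
of the smooth algebra `B'_{det}`.) Conclusion in finite form: some `s ∉ 𝔮'` kills `f̃_j`.
[cite: StacksProject, Tag 07CR] -/
theorem exists_notMem_mul_fB'_eq_zero [IsNoetherianRing R]
    (h34 : LiftCond P (algebraMap R A π) c hcm) {r₀ : R}
    (hr₀ : ∀ s : R, π ^ 2 * s = 0 → π * (r₀ * s) = 0)
    (𝔮' : Ideal (B'alg P hcm π r Bm u t)) [𝔮'.IsPrime] (hπ : algebraMap R _ π ∈ 𝔮')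
    (hr₀𝔮 : algebraMap R _ r₀ ∉ 𝔮') (j : Fin m) :
    ∃ s ∉ 𝔮', s * fB' P hcm π r Bm u t j = 0 := by
  classical
  let D : B'alg P hcm π r Bm u t := (preB' P hcm π r Bm u t).jacobian
  have hD : D ∉ 𝔮' := jacobian_notMem P hcm π r Bm u t hu hπ
  let B'' := Localization.Away D
  haveI : Algebra.Smooth R B'' := smooth_away_jacobian P hcm π r Bm u t
  haveI : IsNoetherianRing (B'alg P hcm π r Bm u t) :=
    Algebra.FiniteType.isNoetherianRing R _
  haveI : IsNoetherianRing B'' :=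
    IsLocalization.isNoetherianRing (Submonoid.powers D) B'' inferInstance
  have hdisj : Disjoint (Submonoid.powers D : Set (B'alg P hcm π r Bm u t)) (𝔮' : Set _) := by
    rw [Set.disjoint_left]
    rintro _ ⟨k, rfl⟩ hk
    exact hD (‹𝔮'.IsPrime›.mem_of_pow_mem k hk)
  let 𝔮'' : Ideal B'' := 𝔮'.map (algebraMap _ B'')
  haveI h𝔮'' : 𝔮''.IsPrime :=
    IsLocalization.isPrime_of_isPrime_disjoint (Submonoid.powers D) B'' 𝔮' ‹_› hdisj
  have hcomap : 𝔮''.comap (algebraMap (B'alg P hcm π r Bm u t) B'') = 𝔮' :=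
    IsLocalization.under_map_of_isPrime_disjoint (Submonoid.powers D) B'' ‹𝔮'.IsPrime› hdisj
  let L := Localization.AtPrime 𝔮''
  haveI : IsNoetherianRing L := IsLocalization.isNoetherianRing 𝔮''.primeCompl L inferInstance
  haveI : Module.Flat B'' L := IsLocalization.flat L 𝔮''.primeCompl
  haveI : Module.Flat R L := Module.Flat.trans R B'' L
  let I₀ : Ideal (B'alg P hcm π r Bm u t) := 𝔮''.comap (algebraMap (B'alg P hcm π r Bm u t) B'')
  haveI : I₀.IsPrime := by rw [show I₀ = 𝔮' from hcomap]; infer_instance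
  haveI hL : IsLocalization.AtPrime L I₀ := inferInstance
  -- elements of `L`
  let fL : Fin m → L := fun j => algebraMap (B'alg P hcm π r Bm u t) L (fB' P hcm π r Bm u t j)
  have hπL : algebraMap R L π ∈ IsLocalRing.maximalIdeal L := by
    rw [IsScalarTower.algebraMap_apply R (B'alg P hcm π r Bm u t) L]
    exact (IsLocalization.AtPrime.to_map_mem_maximal_iff L I₀ _).mpr
      (by rw [show I₀ = 𝔮' from hcomap]; exact hπ)
  have hr₀L : IsUnit (algebraMap R L r₀) := by
    rw [IsScalarTower.algebraMap_apply R (B'alg P hcm π r Bm u t) L]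
    exact (IsLocalization.AtPrime.isUnit_to_map_iff L I₀ _).mpr (by
      change algebraMap R _ r₀ ∉ I₀; rw [show I₀ = 𝔮' from hcomap]; exact hr₀𝔮)
  -- (α): `f̃_j = π² y_j`
  have hsq : ∀ j, ∃ y : L, fL j = algebraMap R L π ^ 2 * y := by
    intro j
    by_cases h : (j : ℕ) < c
    · refine ⟨0, ?_⟩
      have h0 : fB' P hcm π r Bm u t j = 0 := by
        have := fB'_castLE P hcm π r Bm u t ht hBm ⟨j, h⟩
        rwa [show Fin.castLE hcm ⟨j, h⟩ = j from Fin.ext rfl] at this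
      simp only [fL, h0, map_zero, mul_zero]
    · obtain ⟨y, hy⟩ := exists_subst_eq_C_sq_mul π r Bm (c := c) (ht j)
      refine ⟨algebraMap (B'alg P hcm π r Bm u t) L (Ideal.Quotient.mk _ y), ?_⟩
      change algebraMap (B'alg P hcm π r Bm u t) L (Ideal.Quotient.mk _ (subst π r Bm (P.relation j)))
        = _
      rw [hy, map_mul, map_mul, ← map_pow,
        IsScalarTower.algebraMap_apply R (B'alg P hcm π r Bm u t) L (π ^ 2)]
      rfl
  choose y hy using hsq
  -- (β): `π f̃_j ∈ J²`, `J = (f̃_1, …, f̃_m)`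
  let J : Ideal L := Ideal.span (Set.range fL)
  have hβ : ∀ j, algebraMap R L π * fL j ∈ J ^ 2 := by
    intro j
    have := Ideal.mem_map_of_mem (algebraMap (B'alg P hcm π r Bm u t) L)
      (pi_mul_fB'_mem_sq P hcm π r Bm u t ht hBm h34 j)
    rw [map_mul, Ideal.map_pow, Ideal.map_span, ← Set.range_comp,
      ← IsScalarTower.algebraMap_apply] at this
    exact this
  -- `J² ⊆ π N` where `N = π J`
  let N : Ideal L := Ideal.span {algebraMap R L π} * J
  have hJ2 : J ^ 2 ≤ Ideal.span {algebraMap R L π} * N := by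
    rw [pow_two, Ideal.span_mul_span', Ideal.span_le]
    rintro _ ⟨_, ⟨a, rfl⟩, _, ⟨b, rfl⟩, rfl⟩
    change fL a * fL b ∈ Ideal.span {algebraMap R L π} * N
    rw [hy a, show algebraMap R L π ^ 2 * y a * fL b =
      algebraMap R L π * (algebraMap R L π * (y a * fL b)) by ring]
    refine Ideal.mul_mem_mul (Ideal.mem_span_singleton_self _)
      (Ideal.mul_mem_mul (Ideal.mem_span_singleton_self _) ?_)
    exact Ideal.mul_mem_left _ _ (Ideal.subset_span ⟨b, rfl⟩)
  have hN : N = Ideal.span (Set.range fun j => algebraMap R L π * fL j) := by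
    change Ideal.span _ * Ideal.span _ = _
    rw [Ideal.span_mul_span', Set.singleton_mul, ← Set.range_comp]
    rfl
  have hNle : N ≤ Ideal.span {algebraMap R L π} • N := by
    rw [hN, Ideal.span_le, Set.range_subset_iff]
    intro j
    rw [← hN]
    exact hJ2 (hβ j)
  have hNbot : N = ⊥ := by
    refine Submodule.eq_bot_of_le_smul_of_le_jacobson_bot _ N (IsNoetherian.noetherian N) hNle ?_
    rw [IsLocalRing.jacobson_eq_maximalIdeal ⊥ bot_ne_top, Ideal.span_le, Set.singleton_subset_iff]
    exact hπL
  have hπf : ∀ j, algebraMap R L π * fL j = 0 := fun j => by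
    have : algebraMap R L π * fL j ∈ N := by rw [hN]; exact Ideal.subset_span ⟨j, rfl⟩
    rwa [hNbot, Ideal.mem_bot] at this
  -- (γ)–(δ): `f̃_j = 0` in `L`
  have hfL : fL j = 0 := by
    have h3 : algebraMap R L π ^ 2 * (algebraMap R L π * y j) = 0 := by
      rw [← hπf j, hy j]; ring
    have h2 := pi_mul_eq_zero_of_sq π hr₀ hr₀L _ h3
    have h1 := pi_mul_eq_zero_of_sq π hr₀ hr₀L _ (by rw [pow_two, mul_assoc]; exact h2)
    rw [hy j, pow_two, mul_assoc, h1, mul_zero]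
  -- back to `B'`
  obtain ⟨⟨s, hs⟩, hs0⟩ := (IsLocalization.map_eq_zero_iff I₀.primeCompl L _).mp hfL
  refine ⟨s, ?_, hs0⟩
  change s ∉ I₀ at hs
  rwa [show I₀ = 𝔮' from hcomap] at hs

include ht hBm hu in
set_option maxHeartbeats 800000 in
/-- **The case `π ∈ 𝔮`, `𝔞 ⊄ 𝔮`** (Stacks 07CR: "We claim the surjection `B' → B` induces an
isomorphism of local rings `(B')_{𝔮'} → B_𝔮`. This will conclude the proof"): there is `b ∉ 𝔮`
with `B_b` formally smooth over `R`. Here `b` is the image of `s · det(∂g/∂v)` where `s ∉ 𝔮'`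
kills the `f̃_j` (`exists_notMem_mul_fB'_eq_zero`), and `B_b` is exhibited as a retract of the
formally smooth `B'_{s det}`. [cite: StacksProject, Tag 07CR] -/
theorem exists_formallySmooth_away_of_prime [IsNoetherianRing R]
    (h34 : LiftCond P (algebraMap R A π) c hcm) {r₀ : R}
    (hr₀ : ∀ s : R, π ^ 2 * s = 0 → π * (r₀ * s) = 0)
    (𝔮 : Ideal (Balg P hcm π r Bm u t)) [𝔮.IsPrime] (hπ : algebraMap R _ π ∈ 𝔮)
    (hr₀𝔮 : algebraMap R _ r₀ ∉ 𝔮) :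
    ∃ b : Balg P hcm π r Bm u t, b ∉ 𝔮 ∧ Algebra.FormallySmooth R (Localization.Away b) := by
  classical
  let 𝔮' : Ideal (B'alg P hcm π r Bm u t) := 𝔮.comap (B'toB P hcm π r Bm u t)
  haveI : 𝔮'.IsPrime := Ideal.IsPrime.comap _
  have hπ' : algebraMap R (B'alg P hcm π r Bm u t) π ∈ 𝔮' := by
    change B'toB P hcm π r Bm u t (algebraMap R _ π) ∈ 𝔮
    rwa [AlgHom.commutes]
  have hr₀' : algebraMap R (B'alg P hcm π r Bm u t) r₀ ∉ 𝔮' := by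
    change B'toB P hcm π r Bm u t (algebraMap R _ r₀) ∉ 𝔮
    rwa [AlgHom.commutes]
  choose sj hsj hsj0 using exists_notMem_mul_fB'_eq_zero P hcm π r Bm u t hu ht hBm h34 hr₀ 𝔮' hπ' hr₀'
  let S₀ : B'alg P hcm π r Bm u t := ∏ j, sj j
  have hS₀ : S₀ ∉ 𝔮' := by
    have : S₀ ∈ 𝔮'.primeCompl := prod_mem fun j _ => show sj j ∈ 𝔮'.primeCompl from hsj j
    exact this
  have hS₀f : ∀ j, S₀ * fB' P hcm π r Bm u t j = 0 := fun j => by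
    change (∏ j, sj j) * _ = 0
    rw [← Finset.mul_prod_erase Finset.univ sj (Finset.mem_univ j), mul_comm (sj j), mul_assoc,
      hsj0 j, mul_zero]
  let D : B'alg P hcm π r Bm u t := (preB' P hcm π r Bm u t).jacobian
  have hD : D ∉ 𝔮' := jacobian_notMem P hcm π r Bm u t hu hπ'
  let b₀ : B'alg P hcm π r Bm u t := S₀ * D
  have hb₀ : b₀ ∉ 𝔮' := fun h => (‹𝔮'.IsPrime›.mem_or_mem h).elim hS₀ hD
  let b : Balg P hcm π r Bm u t := B'toB P hcm π r Bm u t b₀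
  have hb : b ∉ 𝔮 := hb₀
  -- `B'_{b₀}` is formally smooth over `R`
  let B₃ := Localization.Away b₀
  haveI : Algebra.FormallySmooth R B₃ := by
    have h1 : (↑(PrimeSpectrum.basicOpen D) : Set (PrimeSpectrum (B'alg P hcm π r Bm u t))) ⊆
        Algebra.smoothLocus R (B'alg P hcm π r Bm u t) :=
      Algebra.basicOpen_subset_smoothLocus_iff.mpr
        (smooth_away_jacobian P hcm π r Bm u t).formallySmooth
    refine Algebra.basicOpen_subset_smoothLocus_iff.mp (subset_trans ?_ h1)
    rw [show b₀ = S₀ * D from rfl, PrimeSpectrum.basicOpen_mul]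
    exact fun x hx => hx.2
  -- the retract `B_b → B'_{b₀} → B_b`
  have hS₀unit : IsUnit (algebraMap (B'alg P hcm π r Bm u t) B₃ S₀) :=
    isUnit_of_mul_isUnit_left (by
      rw [← map_mul]
      exact IsLocalization.Away.algebraMap_isUnit (S := B₃) b₀)
  let φ₀ : Balg P hcm π r Bm u t →ₐ[R] B₃ :=
    Ideal.Quotient.liftₐ (idealB P hcm π r Bm u t)
      ((IsScalarTower.toAlgHom R (B'alg P hcm π r Bm u t) B₃).comp (Ideal.Quotient.mkₐ R _))
      fun a ha => by
        rw [← RingHom.mem_ker]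
        refine (Ideal.span_le.mpr ?_) ha
        rintro _ ⟨j, rfl⟩
        change algebraMap (B'alg P hcm π r Bm u t) B₃ (Ideal.Quotient.mk _ (relB P hcm π r Bm u t j))
          = 0
        by_cases h : (j : ℕ) < c
        · have : Ideal.Quotient.mk (Ideal.span (Set.range (gB' P hcm π r Bm u t)))
              (relB P hcm π r Bm u t j) = 0 := by
            rw [Ideal.Quotient.eq_zero_iff_mem]
            refine Ideal.subset_span ⟨⟨j, h⟩, ?_⟩
            rw [gB', show Fin.castLE hcm ⟨j, h⟩ = j from Fin.ext rfl]
          rw [this, map_zero]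
        · rw [relB_of_not_lt P hcm π r Bm u t j h]
          change algebraMap (B'alg P hcm π r Bm u t) B₃ (fB' P hcm π r Bm u t j) = 0
          refine hS₀unit.mul_right_eq_zero.mp ?_
          rw [← map_mul, hS₀f j, map_zero]
  have hφ₀ : ∀ p, φ₀ (Ideal.Quotient.mk _ p) =
      algebraMap (B'alg P hcm π r Bm u t) B₃ (Ideal.Quotient.mk _ p) := fun p => rfl
  have hφ₀B' : ∀ x, φ₀ (B'toB P hcm π r Bm u t x) = algebraMap _ B₃ x := by
    intro x
    obtain ⟨p, rfl⟩ := Ideal.Quotient.mk_surjective x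
    rfl
  have hunitΦ : ∀ y : Submonoid.powers b, IsUnit (φ₀ y) := by
    rintro ⟨_, k, rfl⟩
    rw [map_pow]
    refine IsUnit.pow k ?_
    change IsUnit (φ₀ (B'toB P hcm π r Bm u t b₀))
    rw [hφ₀B']
    exact IsLocalization.Away.algebraMap_isUnit (S := B₃) b₀
  let Φ : Localization.Away b →ₐ[R] B₃ :=
    IsLocalization.liftAlgHom (M := Submonoid.powers b) (f := φ₀) hunitΦ
  have hunitΨ : ∀ y : Submonoid.powers b₀, IsUnit
      (((IsScalarTower.toAlgHom R (Balg P hcm π r Bm u t) (Localization.Away b)).comp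
        (B'toB P hcm π r Bm u t)) y) := by
    rintro ⟨_, k, rfl⟩
    rw [map_pow]
    exact (IsLocalization.Away.algebraMap_isUnit (S := Localization.Away b) b).pow k
  let Ψ : B₃ →ₐ[R] Localization.Away b :=
    IsLocalization.liftAlgHom (M := Submonoid.powers b₀) (f := _) hunitΨ
  have hΨΦ : Ψ.comp Φ = AlgHom.id R _ := by
    refine AlgHom.coe_ringHom_injective (IsLocalization.ringHom_ext (Submonoid.powers b) ?_)
    refine Ideal.Quotient.ringHom_ext (RingHom.ext fun p => ?_)
    change Ψ (Φ (algebraMap (Balg P hcm π r Bm u t) (Localization.Away b)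
      (Ideal.Quotient.mk (idealB P hcm π r Bm u t) p))) =
      algebraMap (Balg P hcm π r Bm u t) (Localization.Away b)
        (Ideal.Quotient.mk (idealB P hcm π r Bm u t) p)
    rw [show Φ (algebraMap (Balg P hcm π r Bm u t) (Localization.Away b)
        (Ideal.Quotient.mk (idealB P hcm π r Bm u t) p)) = φ₀ (Ideal.Quotient.mk _ p)
      from IsLocalization.lift_eq hunitΦ _, hφ₀,
      show Ψ (algebraMap (B'alg P hcm π r Bm u t) B₃ (Ideal.Quotient.mk _ p)) = _
        from IsLocalization.lift_eq hunitΨ _]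
    rfl
  exact ⟨b, hb, formallySmooth_of_retract Φ Ψ hΨΦ⟩

end Bprime

/-! ## ST7. Assembly: the desingularization lemma -/

section Main

variable {R : Type u} [CommRing R] {A : Type u} [CommRing A] [Algebra R A] {n m c : ℕ}
  (P : Algebra.Presentation R A (Fin n) (Fin m)) (hcm : c ≤ m)
  (π : R) (r : Fin n → R) (Bm : Matrix (Fin c) (Fin n) R) (u : R) (t : Fin m → R)
  {t₀ : R} (hu : u = 1 - π ^ 3 * t₀)
  (ht : ∀ j, aeval r (P.relation j) = π ^ 4 * t j)
  (hBm : Bm * Jr P hcm r = (u * π) • (1 : Matrix (Fin c) (Fin c) R))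

include hu ht hBm in
/-- **`𝔞B ⊆ H_{B/R}`** for the algebra `B` of the construction. [cite: StacksProject, Tag 07CR] -/
theorem algebraMap_mem_singularIdeal [IsNoetherianRing R] [Algebra.FormallySmooth R (Aπ A π)]
    (h34 : LiftCond P (algebraMap R A π) c hcm) {r₀ : R}
    (hr₀ : ∀ s : R, π ^ 2 * s = 0 → π * (r₀ * s) = 0) :
    algebraMap R (Balg P hcm π r Bm u t) r₀ ∈ singularIdeal R (Balg P hcm π r Bm u t) := by
  rw [mem_singularIdeal_iff]
  intro x hx
  by_cases hπx : algebraMap R (Balg P hcm π r Bm u t) π ∈ x.asIdeal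
  · obtain ⟨b, hb, hfs⟩ := exists_formallySmooth_away_of_prime P hcm π r Bm u t hu ht hBm h34 hr₀
      x.asIdeal hπx hx
    exact (Algebra.basicOpen_subset_smoothLocus_iff (f := b)).mpr hfs hb
  · exact (Algebra.basicOpen_subset_smoothLocus_iff
      (f := algebraMap R (Balg P hcm π r Bm u t) π)).mpr (formallySmooth_Bπ P hcm π r Bm u t ht hBm) hπx

end Main

end Stacks07CR

open Stacks07CR in
/-- **Stacks, Lemma 07CR (the desingularization lemma).** Let `R` be a Noetherian ring, `Λ` an
`R`-algebra and `π ∈ R` with `Ann_Λ(π) = Ann_Λ(π²)`. Let `φ : A → Λ` be an `R`-algebra map with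
`A` of finite presentation such that (1) the image of `π` is strictly standard in `A` over `R`
(Definition 07C7, `IsStrictlyStandard`) and (2) there is an `R`-algebra map ("section")
`ρ : A/π⁴A → R/π⁴R` compatible with the maps to `Λ/π⁴Λ` (rendered: if `ρ(ā) = r̄'` then
`φ(a) ≡ r' mod π⁴Λ`). Then there are `R`-algebra maps
`A → B → Λ` composing to `φ`, with `B` of finite presentation, such that `𝔞B ⊆ H_{B/R}` where
`𝔞 = Ann_R(Ann_R(π²)/Ann_R(π))`, i.e. every `r ∈ R` with `r · Ann_R(π²) ⊆ Ann_R(π)` maps into the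
singular ideal `H_{B/R}` (`singularIdeal`, Stacks 07C5). Proof as printed (see the module
docstrings of this file and of `NeronPopescuDesingularizationAlgebra`): `A_π` is smooth by
Elkik's Lemma 07CA (`IsStrictlyStandard.formallySmooth`). [cite: StacksProject, Tag 07CR] -/
theorem Stacks07CR_desingularization {R : Type u} [CommRing R] [IsNoetherianRing R]
    {Λ : Type u} [CommRing Λ] [Algebra R Λ] (π : R)
    (hΛ : ∀ x : Λ, algebraMap R Λ π ^ 2 * x = 0 → algebraMap R Λ π * x = 0)
    {A : Type u} [CommRing A] [Algebra R A] [Algebra.FinitePresentation R A] (φ : A →ₐ[R] Λ)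
    (hπ : IsStrictlyStandard R (algebraMap R A π))
    (ρ : (A ⧸ Ideal.span {algebraMap R A π ^ 4}) →ₐ[R] R ⧸ Ideal.span {π ^ 4})
    (hρ : ∀ (a : A) (r' : R), ρ (Ideal.Quotient.mk _ a) = Ideal.Quotient.mk _ r' →
      φ a - algebraMap R Λ r' ∈ Ideal.span {algebraMap R Λ π ^ 4}) :
    ∃ (B : Type u) (_ : CommRing B) (_ : Algebra R B) (f : A →ₐ[R] B) (g : B →ₐ[R] Λ),
      Algebra.FinitePresentation R B ∧ (∀ a, g (f a) = φ a) ∧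
      ∀ r₀ : R, (∀ s : R, π ^ 2 * s = 0 → π * (r₀ * s) = 0) →
        algebraMap R B r₀ ∈ singularIdeal R B := by
  classical
  haveI : Algebra.FormallySmooth R (Aπ A π) := hπ.formallySmooth
  obtain ⟨n, m, P, c, hcn, hcm, ⟨coef, h33⟩, h34⟩ := hπ
  -- the centre `r` : `ρ(x_i) = r_i mod π⁴`
  choose r hr using fun i => Ideal.Quotient.mk_surjective (ρ (Ideal.Quotient.mk _ (P.val i)))
  have hρq : ∀ q : MvPolynomial (Fin n) R,
      ρ (Ideal.Quotient.mk _ (aeval P.val q)) = Ideal.Quotient.mk _ (aeval r q) := by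
    intro q
    have h : (ρ.comp (Ideal.Quotient.mkₐ R _)).comp (aeval P.val) =
        (Ideal.Quotient.mkₐ R (Ideal.span {π ^ 4})).comp (aeval r) :=
      MvPolynomial.algHom_ext fun i => by simp [hr]
    exact AlgHom.congr_fun h q
  -- `f_j(r) = π⁴ t_j`
  have ht' : ∀ j, ∃ tj : R, aeval r (P.relation j) = π ^ 4 * tj := by
    intro j
    have := hρq (P.relation j)
    rw [P.aeval_val_relation, map_zero, map_zero, eq_comm, Ideal.Quotient.eq_zero_iff_mem,
      Ideal.mem_span_singleton'] at this
    obtain ⟨tj, htj⟩ := this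
    exact ⟨tj, by rw [← htj, mul_comm]⟩
  choose t ht using ht'
  -- `uπ = ∑_p r_p det(r_{ji})`, `u = 1 - π³ t₀`
  choose cp hcp using fun p : Fin c → Fin n =>
    Ideal.Quotient.mk_surjective (ρ (Ideal.Quotient.mk _ (coef p)))
  have hJr : ∀ p : Fin c → Fin n, aeval r (jacobianMinor P.relation hcm p) =
      ((Jr P hcm r).submatrix p id).det := by
    intro p
    rw [jacobianMinor, AlgHom.map_det, AlgHom.mapMatrix_apply]
    rfl
  have h33' : ∃ t₀ : R, π - ∑ p, cp p * ((Jr P hcm r).submatrix p id).det = π ^ 4 * t₀ := by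
    have hl : ρ (Ideal.Quotient.mk _ (algebraMap R A π)) = Ideal.Quotient.mk _ π := by
      rw [← Ideal.Quotient.mkₐ_eq_mk R, ← AlgHom.comp_apply]
      exact AlgHom.commutes _ π
    have key := congrArg (fun a => ρ (Ideal.Quotient.mk _ a)) h33
    simp only [map_sum, map_mul, hl] at key
    have key' : Ideal.Quotient.mk (Ideal.span {π ^ 4}) π =
        Ideal.Quotient.mk (Ideal.span {π ^ 4}) (∑ p, cp p * ((Jr P hcm r).submatrix p id).det) := by
      rw [key, map_sum]
      refine Finset.sum_congr rfl fun p _ => ?_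
      rw [map_mul, hcp, hρq, hJr]
    obtain ⟨t₀, ht₀⟩ := Ideal.mem_span_singleton'.mp (Ideal.Quotient.eq.mp key')
    exact ⟨t₀, by rw [← ht₀, mul_comm]⟩
  obtain ⟨t₀, ht₀⟩ := h33'
  set u : R := 1 - π ^ 3 * t₀ with hu
  have hsum : u * π = ∑ p, cp p * ((Jr P hcm r).submatrix p id).det := by
    rw [hu, show (1 - π ^ 3 * t₀) * π = π - π ^ 4 * t₀ by ring, ← ht₀]
    ring
  obtain ⟨Bm, hBm⟩ := exists_matrix_mul_eq_smul_one (Jr P hcm r) cp (u * π) hsum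
  -- `φ(x_i) = r_i + π⁴ λ_i`
  have hlam' : ∀ i, ∃ l : Λ, φ (P.val i) = algebraMap R Λ (r i) + algebraMap R Λ π ^ 4 * l := by
    intro i
    obtain ⟨l, hl⟩ := Ideal.mem_span_singleton'.mp (hρ (P.val i) (r i) (hr i).symm)
    exact ⟨l, by rw [mul_comm] at hl; rw [hl]; ring⟩
  choose lam hlam using hlam'
  refine ⟨Balg P hcm π r Bm u t, inferInstance, inferInstance, toB P hcm π r Bm u t ht hBm,
    toΛ P hcm π r Bm u t ht hBm φ lam hlam hΛ hu, inferInstance,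
    toΛ_toB P hcm π r Bm u t ht hBm φ lam hlam hΛ hu, fun r₀ hr₀ => ?_⟩
  exact algebraMap_mem_singularIdeal P hcm π r Bm u t hu ht hBm h34 hr₀

end Literature.AlgebraicGeometry.Resolution

end
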